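import Summits.Langlands.Langlands.Theses.PrimeSwitchSplit

/-!
# Birth skeleton (BC3) for crux stmt-Langlands-18084
`Summit.Langlands.Langlands.Theses.PrimeSwitchSplit.CompatibilityAwayFromLR` (L∤R) — line `birth`

THE CRUX (route PrimeSwitchSplit, rank 5; Taylor 2004 Conj. 7 at the places `v ∤ ℓ`, `∀ Rec` form):
for every number field `K`, EVERY pinned reciprocity datum `Rec`, `n ≥ 1`, every L-algebraic
cuspidal `π` of `GL_n(𝔸_K)`, every `(ℓ, ι)` and every IRREDUCIBLE `ρ : Γ_K → GL_n(ℚ̄_ℓ)` that is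
pinned-geometric and Satake–Frobenius compatible with `(π, ι)` at almost all places:
`LocalGlobalCompatibleAt Rec ι π ρ v` at every finite `v ∤ ℓ`.

## The line (four named stubs, composition kernel-checked)

Split the places `v ∤ ℓ` into the SATAKE places (where `SatakeFrobCompatibleAt ι π ρ v` holds —
all but finitely many) and the EXCEPTIONAL ones, and split the datum layer `∀ Rec` into ONE datum
plus RIGIDITY:

* `stub_goodPlaces` (G, known): at a Satake place `v ∤ ℓ` the summit's clause holds for EVERY `Rec`
  — unramified local Langlands = the Satake parameter (Jacquet–Shalika unramified computation +
  clause (iii-L) of `IsLocalLanglandsGL`).  In tree: `n ≥ 2` is the landed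
  `ReciprocityUpToIrreducibility.localGlobalCompatibleAt_of_satakeFrobCompatibleAt` /
  `stub_rankN_localGlobalCompatibleAt_of_satakeFrobCompatibleAt` (Theorems/…UnramifiedMatchingGLn,
  fact-free at `v ∤ ℓ`); `n = 1` is the RankOne* sector (`rankOne_localGlobalCompatibleAt_of_…`).
* `stub_recRigidity` (R, known modulo printed local facts): two pinned reciprocity data agree on the
  class of every local component of an (L-algebraic) cuspidal `π` — Henniart's uniqueness of `rec_v`
  on generic classes.  In tree: the conclusion of the landed glue
  `ReciprocityUpToIrreducibilityR.stub_recRigidityLAlg_of_genericRigidity ∘ stub_genericRigidity_of_facts`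
  (Theorems/…RRigidityGlue, …RGenericRigidityOfFacts), i.e. provable from the five local facts
  (h1) `localLanglands_gl`, (h2) generic preimages, (h3) Henniart 2002 Thm 1.7(a), (h4) Henniart
  2002 Thm 1.6(b), (h5) invariant measures on `GL_m ⧸ U_m`.
* `stub_semisimpleMatchingOneDatum` (S, OPEN — the Weil-group half of Taylor's Conj. 7 away from
  `ℓ`): for SOME pinned datum `Rec₀` per field, at every exceptional place `v ∤ ℓ` of an irreducible
  pinned-geometric Satake avatar `ρ` of `π`: the local component `π_v`, a Weil–Deligne module
  `W = WD(ρ|_{W_{K_v}})` (Grothendieck–Deligne recipe), its transport `Wℂ = ι W` and a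
  Frobenius-semisimple representative `S` of `rec_v(π_v)` with `tr Wℂ = tr S` on `W_{K_v}`
  (matching up to semisimplification).  Known: regular algebraic `π` over totally real / CM `K`
  (Varma 2024 Thm 1–2, vendored `Varma2024.theorem12_trace_eq_and_precI`, HLTT convention; the
  polarizable case Harris–Taylor / Taylor–Yoshida / Shin / Caraiani 2012); open for irregular `π`
  and general `K`.
* `stub_monodromyUpgrade` (N, OPEN — the monodromy half, "maximal monodromy for avatars"): for EVERY
  `Rec`, every `v ∤ ℓ`, every local component `π_v`, every `W = WD(ρ|_v)` with transport `Wℂ` and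
  every Frobenius-semisimple `S ∈ rec_v(π_v)`: `tr Wℂ = tr S` on `W_{K_v}` ⟹ `Wℂ^{F-ss} ≅ S`
  (`Wℂ.HasFrobSemisimpleClass (rec_v π_v)`).  Content: `π_v` is generic, so `rec_v(π_v)` carries the
  MAXIMAL monodromy operator on its semisimplification; the claim is that `WD(ρ|_v)` does too —
  weight–monodromy / purity for automorphic Galois representations (Taylor–Yoshida 2007, Caraiani
  2012 in the polarizable regular case; Varma 2024 proves only `Wℂ ≺_I S`; open otherwise).

Composition `CompatibilityAwayFromLR_of : G → R → S → N → L∤R` (hypotheses = the stub statements BY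
NAME, `_Goal.stub_*`, each literally the type of its stub; no `sorry` outside the four
`stub_*`): fix `Rec`, `v ∤ ℓ`; if `v` is a Satake place, G at `Rec`; otherwise S gives
`(π_v, W, Wℂ, S)` for `Rec₀`, N at `Rec₀` upgrades the trace identity to
`Wℂ.HasFrobSemisimpleClass (rec_{Rec₀,v} π_v)`, which assembles `LocalGlobalCompatibleAt Rec₀ ι π ρ v`
(the `v ∣ ℓ` clause is vacuous), and R moves it from `Rec₀` to `Rec`
(`localGlobalCompatibleAt_transfer`, proved here).

Disproof used: no `Disproof.lean` exists for this crux (2026-08-17); the landed Negative-lane lemma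
`Theorems/CompatibilityAwayFromLR/Negative/RigidOfCompatibilityAwayFromLR.lean`
(`recGL_eq_of_compatibilityAwayFromLR`: L∤R FORCES datum rigidity on avatar-bearing local
components) is honoured — that rigidity is exactly stub R, stated for all local components.
Refuter's birth attack (CRUX-ATTACK-r1.md): survives; `∀ Rec` = one datum + rigidity
(`crux_of_exists_form`) — the S/R cut of this skeleton.
-/

set_option linter.dupNamespace false

noncomputable section

namespace Summit.Langlands.Langlands.Cruxes.CompatibilityAwayFromLR.Birth

open scoped MatrixGroups NumberField
open IsDedekindDomain Filter
open Literature.NumberTheory.Automorphic Literature.NumberTheory.GaloisRepresentations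
open Summit.Langlands Summit.Langlands.Langlands.Theses.PrimeSwitchSplit

/-! ## 1. The stubs -/

/-- **STUB G — the Satake places, for EVERY reciprocity datum** (known; Buzzard–Gee's unramified
clause IS Taylor's clause at `v ∤ ℓ`): for `π` cuspidal on `GL_n(𝔸_K)` (`n ≥ 1`), any framed
`ρ : Γ_K → GL_n(ℚ̄_ℓ)`, any `Rec` and any `v ∤ ℓ` with `SatakeFrobCompatibleAt ι π ρ v`, the summit's
`LocalGlobalCompatibleAt Rec ι π ρ v` holds: `ρ|_v` is unramified, `WD = (ρ|_{W_v}, N = 0)`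
(Grothendieck–Deligne with trivial monodromy), and every Frobenius-semisimple representative of
`rec_v(π_v)` is unramified with `char(Φ) = ∏ (X − α_j)` (clause (iii-L) + the Jacquet–Shalika
unramified `L`-factor), which is the Satake clause transported along `ι`.  In tree for `n ≥ 2`
(`ReciprocityUpToIrreducibility.localGlobalCompatibleAt_of_satakeFrobCompatibleAt`, fact-free at
`v ∤ ℓ`) and for `n = 1` (RankOne* sector).  No L-algebraicity, irreducibility or geometricity is
needed. [cite: BuzzardGeeLMS2014, Conj. 3.2.1–3.2.2] [cite: JacquetShalika1981, §2]
[cite: TateCorvallis1979, (4.1.3)–(4.2.1)] -/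
theorem stub_goodPlaces :
    ∀ (K : Type) [Field K] [NumberField K] (Rec : ReciprocityData K) (n : ℕ)
      (hcpt : isCompact_glFiniteIntegralLevel n K), 0 < n →
      ∀ (π : CuspidalAutomorphicRepData n K hcpt) (ℓ : ℕ) [Fact ℓ.Prime] (ι : PadicAlgCl ℓ ≃+* ℂ)
        (ρ : FramedGaloisRep K (PadicAlgCl ℓ) n) (v : HeightOneSpectrum (𝓞 K)),
        ((ℓ : ℕ) : 𝓞 K) ∉ v.asIdeal → SatakeFrobCompatibleAt ι π.1 ρ v →
          LocalGlobalCompatibleAt Rec ι π.1 ρ v := by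
  sorry

/-- **STUB R — rigidity of pinned reciprocity data on local components of cuspidal `π`** (known
modulo printed local facts; Henniart's uniqueness of `rec_v`): any two reciprocity data `Rec`,
`Rec'` of `K` (both pinned to THE canonical Artin maps) give the same class
`rec_v(π_v) ∈ Φ^{F-ss}(GL_n)` to every local component `π_v` of every (L-algebraic) cuspidal `π` on
`GL_n(𝔸_K)`, `n ≥ 1`.  Local components are generic (Shalika; in tree), and on GENERIC classes two
six-clause families for the canonical normalising pair agree (landed
`ReciprocityUpToIrreducibilityR.stub_genericRigidity_of_facts`, from (h1) `localLanglands_gl`,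
(h2) generic preimages of indecomposable parameters, (h3) Henniart 2002 Thm 1.7 (a), (h4) Henniart
2002 Thm 1.6 (b), (h5) invariant measures); the glue to this statement is the landed
`stub_recRigidityLAlg_of_genericRigidity`.  Verbatim the refuter's `RigidityOnLocalComponents`.
[cite: Henniarts1993, Thm 1.1] [cite: HenniartBSMF2002, Thm. 1.6 (b) and Thm. 1.7 (a)]
[cite: HarrisTaylorAMS2001, Thm. A] [cite: Shalika1974, Thm 5.5] -/
theorem stub_recRigidity :
    ∀ (K : Type) [Field K] [NumberField K] (Rec Rec' : ReciprocityData K) (n : ℕ)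
      (hcpt : isCompact_glFiniteIntegralLevel n K), 0 < n →
      ∀ (π : CuspidalAutomorphicRepData n K hcpt), π.1.IsLAlgebraic →
        ∀ (v : HeightOneSpectrum (𝓞 K)) (πv : SmoothIrrep (GL (Fin n) (v.adicCompletion K))),
          π.1.HasLocalComponentAt v πv.ρ →
            (Rec.llc v).recGL n (IrrClass.mk πv) = (Rec'.llc v).recGL n (IrrClass.mk πv) := by
  sorry

/-- **STUB S — matching up to semisimplification at the exceptional places, for ONE datum** (OPEN;
the Weil-group half of Taylor's Conj. 7 at `v ∤ ℓ`): for every number field `K` carrying reciprocity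
data there is a pinned datum `Rec₀` such that, for every L-algebraic cuspidal `π` of `GL_n(𝔸_K)`
(`n ≥ 1`), every `(ℓ, ι)`, every IRREDUCIBLE pinned-geometric `ρ` Satake–Frobenius compatible with
`(π, ι)` a.e., and every place `v ∤ ℓ` at which Satake–Frobenius compatibility FAILS (finitely
many): there are the local component `π_v`, a Weil–Deligne module `W` attached to `ρ|_{W_{K_v}}` by
the Grothendieck–Deligne recipe, its transport `Wℂ` along `ι`, and a Frobenius-semisimple
representative `S` of `rec_{Rec₀,v}(π_v)` with `tr Wℂ(w) = tr S(w)` for every `w ∈ W_{K_v}`.  Known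
for regular algebraic `π` over totally real / CM `K` (Varma 2024 Thm 1–2, in tree as the named
fact `Varma2024.theorem12_trace_eq_and_precI` in the HLTT convention; polarizable case:
Harris–Taylor, Taylor–Yoshida, Shin, Chenevier–Harris, Caraiani 2012); open for irregular `π` and
for `K` neither totally real nor CM.  The prover picks the datum (e.g. Harris–Taylor's `rec`).
[cite: TaylorGaloisRepresentations2004, Conj. 7 (= Conj. 3.4 of the long version)]
[cite: VarmaFMS2024, Thm. 1 and Thm. 2] [cite: HarrisTaylorAMS2001, Thm. B] [cite: Caraiani2012, Thm. 1.1] -/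
theorem stub_semisimpleMatchingOneDatum :
    ∀ (K : Type) [Field K] [NumberField K], Nonempty (ReciprocityData K) →
      ∃ Rec : ReciprocityData K, ∀ (n : ℕ) (hcpt : isCompact_glFiniteIntegralLevel n K), 0 < n →
        ∀ (π : CuspidalAutomorphicRepData n K hcpt), π.1.IsLAlgebraic →
        ∀ (ℓ : ℕ) [Fact ℓ.Prime] (ι : PadicAlgCl ℓ ≃+* ℂ) (ρ : FramedGaloisRep K (PadicAlgCl ℓ) n),
          ρ.toGaloisRep.IsIrreducible →
          ((∀ᶠ v : HeightOneSpectrum (𝓞 K) in cofinite, ρ.IsUnramifiedAt v) ∧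
            ∀ (v : HeightOneSpectrum (𝓞 K)) (hv : ((ℓ : ℕ) : 𝓞 K) ∈ v.asIdeal),
              (Literature.NumberTheory.PAdicHodge.fontainePstAdicCompletion v ℓ hv).IsDeRhamFramed
                (ρ.toLocal v)) →
          (∀ᶠ v : HeightOneSpectrum (𝓞 K) in cofinite, SatakeFrobCompatibleAt ι π.1 ρ v) →
          ∀ v : HeightOneSpectrum (𝓞 K), ((ℓ : ℕ) : 𝓞 K) ∉ v.asIdeal →
            ¬ SatakeFrobCompatibleAt ι π.1 ρ v →
            ∃ (πv : SmoothIrrep (GL (Fin n) (v.adicCompletion K)))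
              (W : WeilDeligneRep (v.adicCompletion K) (PadicAlgCl ℓ) (Fin n → PadicAlgCl ℓ))
              (Wℂ : WeilDeligneRep (v.adicCompletion K) ℂ (Fin n → ℂ))
              (S : WeilDeligneRep (v.adicCompletion K) ℂ (Fin n → ℂ)) (hS : S.IsFrobSemisimple),
              π.1.HasLocalComponentAt v πv.ρ ∧
              IsWeilDeligneOfLadic (ρ.toLocal v).toWeilGroupHom W ∧
              W.IsTransportAlong (ι : PadicAlgCl ℓ →+* ℂ) Wℂ ∧
              Quotient.mk (frobSemisimpleWDSetoid (v.adicCompletion K) n) ⟨S, hS⟩ =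
                (Rec.llc v).recGL n (IrrClass.mk πv) ∧
              ∀ w : WeilGroup (v.adicCompletion K),
                LinearMap.trace ℂ (Fin n → ℂ) (Wℂ.ρ w) = LinearMap.trace ℂ (Fin n → ℂ) (S.ρ w) := by
  sorry

/-- **STUB N — the monodromy upgrade ("maximal monodromy for automorphic Galois representations at
`v ∤ ℓ`")** (OPEN; the monodromy half of Taylor's Conj. 7): for EVERY `Rec`, every L-algebraic
cuspidal `π` of `GL_n(𝔸_K)` (`n ≥ 1`), every IRREDUCIBLE pinned-geometric `ρ` Satake–Frobenius
compatible with `(π, ι)` a.e., every `v ∤ ℓ`, every local component `π_v` of `π` at `v`, every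
Weil–Deligne module `W` attached to `ρ|_{W_{K_v}}` (Grothendieck–Deligne) with transport `Wℂ` along
`ι`, and every Frobenius-semisimple representative `S` of `rec_{Rec,v}(π_v)`: if `tr Wℂ = tr S` on
`W_{K_v}` then `Wℂ^{F-ss} ≅ S`, i.e. `Wℂ.HasFrobSemisimpleClass (rec_{Rec,v} π_v)`.  Content: `π_v`
is generic (Shalika), so `S` carries the MAXIMAL monodromy operator on its Frobenius-semisimple
Weil part (generic ⟺ `L(s, Ad ∘ φ)` holomorphic at `s = 1` ⟺ open `N`-orbit); the trace identity
fixes `Wℂ^{ss} ≅ S^{ss}`; the claim is that `N(WD(ρ|_v))` is maximal as well — weight–monodromy /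
purity of automorphic Galois representations (Taylor–Yoshida 2007 and Caraiani 2012 in the
polarizable regular case; Varma 2024 has only `Wℂ ≺_I S`; irregular `π`, non-polarizable `N` and
general `K` open).  Implied by the crux via Deligne's independence of `(t, U, Φ)`
(`IsWeilDeligneOfLadic.isEquivalent`) and uniqueness of local components.
[cite: TaylorYoshida2007, Thm. 1.2] [cite: Caraiani2012, Thm. 1.1] [cite: VarmaFMS2024, Thm. 2]
[cite: DeligneAntwerpII1973, §8.4.2] -/
theorem stub_monodromyUpgrade :
    ∀ (K : Type) [Field K] [NumberField K] (Rec : ReciprocityData K) (n : ℕ)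
      (hcpt : isCompact_glFiniteIntegralLevel n K), 0 < n →
      ∀ (π : CuspidalAutomorphicRepData n K hcpt), π.1.IsLAlgebraic →
      ∀ (ℓ : ℕ) [Fact ℓ.Prime] (ι : PadicAlgCl ℓ ≃+* ℂ) (ρ : FramedGaloisRep K (PadicAlgCl ℓ) n),
        ρ.toGaloisRep.IsIrreducible →
        ((∀ᶠ v : HeightOneSpectrum (𝓞 K) in cofinite, ρ.IsUnramifiedAt v) ∧
          ∀ (v : HeightOneSpectrum (𝓞 K)) (hv : ((ℓ : ℕ) : 𝓞 K) ∈ v.asIdeal),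
            (Literature.NumberTheory.PAdicHodge.fontainePstAdicCompletion v ℓ hv).IsDeRhamFramed
              (ρ.toLocal v)) →
        (∀ᶠ v : HeightOneSpectrum (𝓞 K) in cofinite, SatakeFrobCompatibleAt ι π.1 ρ v) →
        ∀ v : HeightOneSpectrum (𝓞 K), ((ℓ : ℕ) : 𝓞 K) ∉ v.asIdeal →
          ∀ (πv : SmoothIrrep (GL (Fin n) (v.adicCompletion K))), π.1.HasLocalComponentAt v πv.ρ →
          ∀ (W : WeilDeligneRep (v.adicCompletion K) (PadicAlgCl ℓ) (Fin n → PadicAlgCl ℓ))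
            (Wℂ : WeilDeligneRep (v.adicCompletion K) ℂ (Fin n → ℂ)),
            IsWeilDeligneOfLadic (ρ.toLocal v).toWeilGroupHom W →
            W.IsTransportAlong (ι : PadicAlgCl ℓ →+* ℂ) Wℂ →
          ∀ (S : WeilDeligneRep (v.adicCompletion K) ℂ (Fin n → ℂ)) (hS : S.IsFrobSemisimple),
            Quotient.mk (frobSemisimpleWDSetoid (v.adicCompletion K) n) ⟨S, hS⟩ =
              (Rec.llc v).recGL n (IrrClass.mk πv) →
            (∀ w : WeilGroup (v.adicCompletion K),
              LinearMap.trace ℂ (Fin n → ℂ) (Wℂ.ρ w) = LinearMap.trace ℂ (Fin n → ℂ) (S.ρ w)) →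
            Wℂ.HasFrobSemisimpleClass ((Rec.llc v).recGL n (IrrClass.mk πv)) := by
  sorry

/-! ## 2. Glue (sorry-free) -/

/-- Local–global compatibility at `v` transfers across two data that agree on the class of every
local component of `π` at `v` (`Rec` enters `LocalGlobalCompatibleAt` only through
`(Rec.llc v).recGL n [π_v]`). [folklore] -/
theorem localGlobalCompatibleAt_transfer {K : Type} [Field K] [NumberField K]
    (Rec Rec' : ReciprocityData K) {n : ℕ} {hcpt : isCompact_glFiniteIntegralLevel n K}
    {ℓ : ℕ} [Fact ℓ.Prime] (ι : PadicAlgCl ℓ ≃+* ℂ)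
    (π : CuspidalAutomorphicRepData n K hcpt) (ρ : FramedGaloisRep K (PadicAlgCl ℓ) n)
    (v : HeightOneSpectrum (𝓞 K))
    (hagree : ∀ πv : SmoothIrrep (GL (Fin n) (v.adicCompletion K)), π.1.HasLocalComponentAt v πv.ρ →
      (Rec.llc v).recGL n (IrrClass.mk πv) = (Rec'.llc v).recGL n (IrrClass.mk πv))
    (h : LocalGlobalCompatibleAt Rec ι π.1 ρ v) : LocalGlobalCompatibleAt Rec' ι π.1 ρ v := by
  obtain ⟨πv, r, rℂ, hloc, haway, habove, htrans, hclass⟩ := h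
  refine ⟨πv, r, rℂ, hloc, haway, habove, htrans, ?_⟩
  rw [← hagree πv hloc]
  exact hclass

/-! ## 3. The stub statements as named propositions (the composition's hypotheses, by name) -/

namespace _Goal

/-- The statement of `stub_goodPlaces`, as a named `Prop` (literally its type). [folklore] -/
def stub_goodPlaces : Prop :=
  type_of% @Summit.Langlands.Langlands.Cruxes.CompatibilityAwayFromLR.Birth.stub_goodPlaces

/-- The statement of `stub_recRigidity`, as a named `Prop` (literally its type). [folklore] -/
def stub_recRigidity : Prop :=
  type_of% @Summit.Langlands.Langlands.Cruxes.CompatibilityAwayFromLR.Birth.stub_recRigidity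

/-- The statement of `stub_semisimpleMatchingOneDatum`, as a named `Prop` (literally its type).
[folklore] -/
def stub_semisimpleMatchingOneDatum : Prop :=
  type_of% @Summit.Langlands.Langlands.Cruxes.CompatibilityAwayFromLR.Birth.stub_semisimpleMatchingOneDatum

/-- The statement of `stub_monodromyUpgrade`, as a named `Prop` (literally its type). [folklore] -/
def stub_monodromyUpgrade : Prop :=
  type_of% @Summit.Langlands.Langlands.Cruxes.CompatibilityAwayFromLR.Birth.stub_monodromyUpgrade

end _Goal

/-! ## 4. The composition (kernel-checked, no `sorry`; concludes the route decl by name) -/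

/-- **`G → R → S → N → CompatibilityAwayFromLR`.**  Fix `Rec`, an avatar `ρ` of `π` as in the crux
and `v ∤ ℓ`.  At a Satake place, stub G at `Rec`.  At an exceptional place, stub S yields, for its
datum `Rec₀`, the local component `π_v`, `W = WD(ρ|_v)`, `Wℂ = ι W` and `S ∈ rec_{Rec₀,v}(π_v)` with
equal traces; stub N (at `Rec₀`) upgrades this to `Wℂ.HasFrobSemisimpleClass (rec_{Rec₀,v} π_v)`;
these assemble `LocalGlobalCompatibleAt Rec₀ ι π ρ v` (the clause above `ℓ` is vacuous at `v ∤ ℓ`),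
and stub R transports it to `Rec`. [folklore] -/
theorem CompatibilityAwayFromLR_of (hG : _Goal.stub_goodPlaces) (hR : _Goal.stub_recRigidity)
    (hS : _Goal.stub_semisimpleMatchingOneDatum) (hN : _Goal.stub_monodromyUpgrade) :
    Summit.Langlands.Langlands.Theses.PrimeSwitchSplit.CompatibilityAwayFromLR := by
  unfold _Goal.stub_goodPlaces at hG
  unfold _Goal.stub_recRigidity at hR
  unfold _Goal.stub_semisimpleMatchingOneDatum at hS
  unfold _Goal.stub_monodromyUpgrade at hN
  intro K _ _ Rec n hcpt hn π hL ℓ _ ι ρ hirr hgeo hρ v hv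
  by_cases hsat : SatakeFrobCompatibleAt ι π.1 ρ v
  · -- a Satake place: stub G at `Rec`
    exact hG K Rec n hcpt hn π ℓ ι ρ v hv hsat
  · -- an exceptional place: S at its datum `Rec₀`, upgraded by N, transported to `Rec` by R
    obtain ⟨Rec₀, h₀⟩ := hS K ⟨Rec⟩
    obtain ⟨πv, W, Wℂ, S, hFS, hloc, hW, htr, hcls, htrace⟩ :=
      h₀ n hcpt hn π hL ℓ ι ρ hirr hgeo hρ v hv hsat
    have hfs : Wℂ.HasFrobSemisimpleClass ((Rec₀.llc v).recGL n (IrrClass.mk πv)) :=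
      hN K Rec₀ n hcpt hn π hL ℓ ι ρ hirr hgeo hρ v hv πv hloc W Wℂ hW htr S hFS hcls htrace
    have h₀v : LocalGlobalCompatibleAt Rec₀ ι π.1 ρ v :=
      ⟨πv, W, Wℂ, hloc, fun _ => hW, fun hv' => absurd hv' hv, htr, hfs⟩
    exact localGlobalCompatibleAt_transfer Rec₀ Rec ι π ρ v
      (fun πv' hπv' => hR K Rec₀ Rec n hcpt hn π hL v πv' hπv') h₀v

/-- By-name sanity check (an `example`, not a declaration of the file): the open stubs feed the
composition as they stand. -/
example : Summit.Langlands.Langlands.Theses.PrimeSwitchSplit.CompatibilityAwayFromLR :=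
  CompatibilityAwayFromLR_of stub_goodPlaces stub_recRigidity stub_semisimpleMatchingOneDatum
    stub_monodromyUpgrade

end Summit.Langlands.Langlands.Cruxes.CompatibilityAwayFromLR.Birth

end
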